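import Mathlib.Analysis.Normed.Group.Ultra
import Mathlib.Analysis.Normed.Unbundled.SpectralNorm
import Mathlib.FieldTheory.KummerExtension
import Mathlib.RingTheory.Norm.Transitivity
import Mathlib.RingTheory.Polynomial.Eisenstein.Criterion
import Mathlib.RingTheory.PowerBasis
import Literature.NumberTheory.GaloisRepresentations.LocalExistenceLubinTate
import Literature.NumberTheory.GaloisRepresentations.LocalGaloisGroupProofs
import HarnessLib

/-!
# The existence theorem of local class field theory — the tame level, proved

Companion to `LocalExistenceLubinTate.lean`, which reduces the existence theorem
`Literature.localExistenceTheorem F` (Serre, *Local Fields*, XIV §6 Thm. 1; the trunk fact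
`exists_intermediateField_normSubgroup_eq` with its local-field binders restored) to the reciprocity
law `Literature.localReciprocityLaw F` and the Lubin–Tate norm-group fact
`Literature.exists_abelian_norm_le_lubinTate F`: for a uniformizer `π` and `n ≥ 1` a finite abelian
`E ⊆ F̄` of degree `(q-1)q^{n-1}` with `π ∈ N(Eˣ)` and `N(Eˣ) ⊆ ⟨π⟩ · U^{(n)}` (Cassels–Fröhlich VI
§3.6 Cor., §3.8).  This file **proves the level `n = 1`** of that fact and deduces the existence
theorem for all subgroups containing the principal units from the reciprocity law alone:

* `Literature.NumberTheory.GaloisRepresentations.exists_abelian_norm_le_lubinTate_one` — for every uniformizer `π` there is a cyclic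
  extension `E = F(α) ⊆ F̄`, `α^{q-1} = (-1)^q π` (the Lubin–Tate field `K_π^1 = K(E_f^1)` for
  `f = πX + X^q`: its nonzero `π`-division points are the roots of `X^{q-1} + π`), of degree
  `q - 1`, with `N(α) = π` and `N(Eˣ) ⊆ ⟨π⟩ · U^{(1)}`;
* `Literature.NumberTheory.GaloisRepresentations.isNormSubgroup_of_higherUnitGroup_one_le` — from `localReciprocityLaw F`: every
  finite-index `U ≤ Fˣ` containing `U^{(1)} = 1 + 𝔭` (equivalently, by `higherUnitGroup_one`,
  Mathlib's `principalUnitGroup`) is a norm group — the *tamely ramified* part of the existence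
  theorem, now independent of Serre XI §5 Prop. 6 and of the levels `n ≥ 2` of the Lubin–Tate fact.

## Proof (Cassels–Fröhlich VI §3.6 at `n = 1`; Serre, *Local Fields*, I §6, II §4, V §2–3)

Let `q = #𝓀[F]`, `d = q - 1`, `c = (-1)^q π` (a uniformizer).
1. `F` contains a primitive `d`-th root of unity (`exists_isPrimitiveRoot_residueFieldCard_sub_one`:
   lift a generator of `𝓀ˣ` and correct it by Hensel's lemma for `X^d - u`, Serre II §4 Prop. 8 —
   the henselian input is `LocalGaloisGroupProofs`' `exists_pow_eq_of_sub_one_mem_maximalIdeal`).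
2. `X^d - c` is irreducible (`irreducible_X_pow_sub_C_of_isUniformizer`: Eisenstein at `𝓂[F]`,
   Mathlib's `irreducible_of_eisenstein_criterion`, then Gauss's lemma).
3. `E = F(α)`, `α^d = c`, is a Kummer extension: Galois and cyclic (Mathlib's
   `isSplittingField_X_pow_sub_C_of_root_adjoin_eq_top`, `isGalois_of_isSplittingField_X_pow_sub_C`,
   `isCyclic_of_isSplittingField_X_pow_sub_C`), of degree `d`, and
   `N(α) = (-1)^d · (-c) = π` (`PowerBasis.norm_gen_eq_coeff_zero_minpoly`).
4. (**`E/F` is totally ramified**, with the spectral norm for the valuation of `E`.)  Since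
   `‖α‖^d = ‖π‖` and `‖Fˣ‖ = ‖π‖^ℤ`, the values `‖a‖ ‖α‖^i` (`a ∈ Fˣ`, `i < d`) are pairwise
   distinct (`eq_of_norm_mul_pow_eq`), so every nonzero `y = Σ_{i<d} a_i α^i` has a unique dominant
   term (`exists_dominant_term`, an ultrametric equality case); hence every `x ∈ Eˣ` is
   `α^i · π^k · b · (1 + m)` with `b ∈ F`, `‖b‖ = 1`, `‖m‖ < 1` (`exists_eq_pow_mul_mul_one_add`;
   Serre I §6 Prop. 17–18).
5. `N(1 + m) = ∏_σ (1 + σ m)` is a principal unit since `‖σ m‖ = ‖m‖ < 1`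
   (`norm_algebraNorm_one_add_sub_one_lt`; Serre V §3), and `b^d = b^{q-1} ≡ 1 mod 𝔭`.  So
   `N(x) = π^{i + kd} · (b^d · N(1+m)) ∈ ⟨π⟩ · U^{(1)}`.
6. The existence theorem for `U ⊇ U^{(1)}` is then `isNormSubgroup_of_higherUnitGroup_le`
   (`LocalExistenceLubinTate.lean`) at `n = 1`, with `h₁, h₂` from the reciprocity law.

## References

* J.-P. Serre, *Local class field theory*, Ch. VI in Cassels–Fröhlich, *Algebraic Number Theory*
  (1967), §3.6 Prop. 6 and Cor. (PDF p. 195 of the held copy), §3.8.  [CasselsFrohlichANT1967]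
* J.-P. Serre, *Local Fields*, GTM 67 (1979): Ch. I §6 Prop. 17–18 (Eisenstein polynomials and
  totally ramified extensions); Ch. II §4 Prop. 7–8 (Hensel; roots of unity of order prime to `p`);
  Ch. V §3 (norms of principal units); Ch. XIV §6 Thm. 1.  [SerreLocalFields1979]
* J. Lubin, J. Tate, *Formal complex multiplication in local fields*, Ann. of Math. 81 (1965).
  [LubinTate1965]

## Mathlib reuse

`KummerExtension` (`isSplittingField_X_pow_sub_C_of_root_adjoin_eq_top`,
`isGalois_of_isSplittingField_X_pow_sub_C`, `isCyclic_of_isSplittingField_X_pow_sub_C`),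
`IsAbelianGalois.of_isCyclic`, `irreducible_of_eisenstein_criterion`,
`Polynomial.Monic.irreducible_iff_irreducible_map_fraction_map`, `IntermediateField.adjoin.powerBasis`,
`Algebra.PowerBasis.norm_gen_eq_coeff_zero_minpoly`, `Algebra.norm_eq_prod_automorphisms`,
`spectralNorm`, `spectralNorm.normedField`, `spectralNorm_eq_of_equiv`, `spectralNorm_extends`,
`IsUltrametricDist.norm_sum_eq_sup'_of_pairwise_ne`, `IsAlgClosed.exists_pow_nat_eq`,
`Valued.toNontriviallyNormedField`; from the tree: `LocalGaloisGroupProofs`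
(`exists_pow_eq_of_sub_one_mem_maximalIdeal`, `pow_residueFieldCard_sub_one_sub_one_mem`,
`cast_residueFieldCard_eq_zero`, `mem_maximalIdeal_iff_valuation_lt_one`).
-/

noncomputable section

open ValuativeRel Valuation Polynomial



namespace Literature.NumberTheory.GaloisRepresentations

/-! ### Ultrametric sums with pairwise distinct norms -/

/-- In an ultrametric normed group, if the nonzero terms of a finite sum have pairwise distinct
norms and the sum is nonzero, then the sum has the norm of a unique dominant term `f i₀`, and the
remaining terms sum to something of smaller norm. [folklore] -/
theorem exists_norm_sum_eq_norm_and_lt {M ι : Type*} [NormedAddCommGroup M]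
    [IsUltrametricDist M] (s : Finset ι) (f : ι → M)
    (hs : ∀ i ∈ s, ∀ j ∈ s, f i ≠ 0 → f j ≠ 0 → ‖f i‖ = ‖f j‖ → i = j)
    (hne : ∑ i ∈ s, f i ≠ 0) :
    ∃ i₀ ∈ s, f i₀ ≠ 0 ∧ ‖∑ i ∈ s, f i‖ = ‖f i₀‖ ∧ ‖∑ i ∈ s, f i - f i₀‖ < ‖f i₀‖ := by
  classical
  set s' := s.filter (fun i => f i ≠ 0) with hs'_def
  have hsum : ∑ i ∈ s, f i = ∑ i ∈ s', f i := by
    rw [hs'_def, Finset.sum_filter_ne_zero]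
  have hs'ne : s'.Nonempty := by
    by_contra h
    rw [Finset.not_nonempty_iff_eq_empty] at h
    rw [hsum, h, Finset.sum_empty] at hne
    exact hne rfl
  have hpw : Set.Pairwise (s' : Set ι) (fun i j => ‖f i‖ ≠ ‖f j‖) := by
    intro i hi j hj hij h
    rw [Finset.mem_coe, hs'_def, Finset.mem_filter] at hi hj
    exact hij (hs i hi.1 j hj.1 hi.2 hj.2 h)
  have hnorm := IsUltrametricDist.norm_sum_eq_sup'_of_pairwise_ne hs'ne hpw
  obtain ⟨i₀, hi₀, hi₀'⟩ := Finset.exists_mem_eq_sup' hs'ne (fun i => ‖f i‖)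
  have hi₀s : i₀ ∈ s ∧ f i₀ ≠ 0 := by
    rw [hs'_def, Finset.mem_filter] at hi₀; exact hi₀
  refine ⟨i₀, hi₀s.1, hi₀s.2, by rw [hsum, hnorm, hi₀'], ?_⟩
  have hrest : ∑ i ∈ s, f i - f i₀ = ∑ i ∈ s'.erase i₀, f i := by
    rw [hsum, ← Finset.sum_erase_add _ _ hi₀, add_sub_cancel_right]
  rw [hrest]
  rcases (s'.erase i₀).eq_empty_or_nonempty with h | h
  · rw [h, Finset.sum_empty, norm_zero]
    exact norm_pos_iff.mpr hi₀s.2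
  · obtain ⟨j, hj, hj'⟩ := IsUltrametricDist.exists_norm_finsetSum_le_of_nonempty h f
    refine hj'.trans_lt (lt_of_le_of_ne ?_ ?_)
    · rw [← hi₀']
      exact Finset.le_sup' (fun i => ‖f i‖) (Finset.mem_of_mem_erase hj)
    · exact hpw (Finset.mem_of_mem_erase hj) hi₀ (Finset.ne_of_mem_erase hj)

/-! ### Totally ramified "Kummer/Eisenstein" structure -/

section TotallyRamified

variable {K : Type*} [NontriviallyNormedField K] [CompleteSpace K] [IsUltrametricDist K]
  {L : Type*} [Field L] [Algebra K L] [FiniteDimensional K L]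

omit [CompleteSpace K] [IsUltrametricDist K] in
/-- If `t^d = ‖π‖` with `‖Kˣ‖ = ‖π‖^ℤ`, `0 < ‖π‖ < 1`, then the values `‖a‖ t^i`, `i < d`, `a ∈ Kˣ`,
lie in distinct classes modulo `‖Kˣ‖`: `‖a‖ t^i = ‖b‖ t^j ⟹ i = j` (the value group of a totally
ramified extension of degree `d` with uniformizer of absolute value `t`). [folklore] -/
theorem eq_of_norm_mul_pow_eq {π : K} (hπ0 : 0 < ‖π‖) (hπ : ‖π‖ < 1)
    (hval : ∀ x : K, x ≠ 0 → ∃ k : ℤ, ‖x‖ = ‖π‖ ^ k) {t : ℝ} {d : ℕ} (ht : 0 < t)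
    (htd : t ^ d = ‖π‖) {a b : K} (ha : a ≠ 0) (hb : b ≠ 0) {i j : ℕ} (hi : i < d) (hj : j < d)
    (h : ‖a‖ * t ^ i = ‖b‖ * t ^ j) : i = j := by
  -- wlog `i ≤ j`
  wlog hij : i ≤ j generalizing a b i j
  · exact (this hb ha hj hi h.symm (le_of_not_ge hij)).symm
  obtain ⟨k, hk⟩ := hval (a / b) (div_ne_zero ha hb)
  have h2 : ‖a‖ = ‖b‖ * t ^ (j - i) := by
    have : t ^ j = t ^ (j - i) * t ^ i := by rw [← pow_add, Nat.sub_add_cancel hij]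
    rw [this, ← mul_assoc] at h
    exact mul_right_cancel₀ (pow_ne_zero _ ht.ne') h
  have h3 : t ^ (j - i) = ‖π‖ ^ k := by
    rw [← hk, norm_div, h2, mul_div_cancel_left₀ _ (norm_ne_zero_iff.mpr hb)]
  have h4 : ‖π‖ ^ ((j - i : ℕ) : ℤ) = ‖π‖ ^ (k * d) :=
    calc ‖π‖ ^ ((j - i : ℕ) : ℤ) = (t ^ d) ^ (j - i) := by rw [zpow_natCast, htd]
      _ = (t ^ (j - i)) ^ d := by rw [← pow_mul, ← pow_mul, mul_comm]
      _ = (‖π‖ ^ k) ^ d := by rw [h3]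
      _ = ‖π‖ ^ (k * d) := by rw [← zpow_natCast, ← zpow_mul]
  have h5 : ((j - i : ℕ) : ℤ) = k * d := zpow_right_injective₀ hπ0 hπ.ne h4
  have h6 : (d : ℤ) ∣ ((j - i : ℕ) : ℤ) := ⟨k, by rw [h5, mul_comm]⟩
  have h7 : d ∣ j - i := Int.natCast_dvd_natCast.mp h6
  have h8 : j - i = 0 := Nat.eq_zero_of_dvd_of_lt h7 (by omega)
  omega

variable (K L) in
/-- **Dominant term.**  Let `pb` be a power basis of `L/K` with generator `α` such that
`‖α‖^{[L:K]} = ‖π‖` (spectral norm) where `‖Kˣ‖ = ‖π‖^ℤ`, `0 < ‖π‖ < 1`.  Then every nonzero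
`y = Σ_{i<d} c_i α^i` has a unique term of maximal absolute value, `‖y‖ = ‖c_{i₀}‖ ‖α‖^{i₀}`, and
the other terms sum to something smaller (the `‖c_i α^i‖` are pairwise distinct, lying in distinct
cosets of `‖Kˣ‖`).  This is the computation showing that an Eisenstein (e.g. `X^d - π`) extension
is totally ramified with `|L^×| = |α|^ℤ`.  Ref: Serre, *Local Fields*, Ch. I §6 Prop. 17–18;
Cassels–Fröhlich Ch. I §6. [folklore] -/
theorem exists_dominant_term {π : K} (hπ0 : 0 < ‖π‖) (hπ : ‖π‖ < 1)
    (hval : ∀ x : K, x ≠ 0 → ∃ k : ℤ, ‖x‖ = ‖π‖ ^ k) (pb : PowerBasis K L)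
    (hα : spectralNorm K L pb.gen ^ pb.dim = ‖π‖) {y : L} (hy : y ≠ 0) :
    ∃ i₀ : Fin pb.dim, pb.basis.repr y i₀ ≠ 0 ∧
      spectralNorm K L y = ‖pb.basis.repr y i₀‖ * spectralNorm K L pb.gen ^ (i₀ : ℕ) ∧
      spectralNorm K L (y - pb.basis.repr y i₀ • pb.gen ^ (i₀ : ℕ)) <
        ‖pb.basis.repr y i₀‖ * spectralNorm K L pb.gen ^ (i₀ : ℕ) := by
  letI := spectralNorm.normedField K L
  haveI : IsUltrametricDist L :=
    IsUltrametricDist.isUltrametricDist_of_forall_norm_add_le_max_norm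
      (fun a b => isNonarchimedean_spectralNorm (K := K) (L := L) a b)
  have hsp : ∀ z : L, spectralNorm K L z = ‖z‖ := fun z => rfl
  set t := spectralNorm K L pb.gen with ht_def
  have ht : 0 < t := by
    rcases (spectralNorm_nonneg (K := K) pb.gen).eq_or_lt with h | h
    · exfalso
      have ht0 : t = 0 := h.symm
      rw [ht0] at hα
      rcases Nat.eq_zero_or_pos pb.dim with hd | hd
      · rw [hd, pow_zero] at hα
        exact hπ.ne hα.symm
      · rw [zero_pow hd.ne'] at hα
        exact hπ0.ne hα
    · exact h
  set c := pb.basis.repr y with hc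
  set f : Fin pb.dim → L := fun i => c i • pb.gen ^ (i : ℕ) with hf
  have hyf : y = ∑ i, f i := by
    conv_lhs => rw [← pb.basis.sum_repr y]
    simp only [hf, PowerBasis.coe_basis]
    rfl
  have hnf : ∀ i, ‖f i‖ = ‖c i‖ * t ^ (i : ℕ) := by
    intro i
    simp only [hf, Algebra.smul_def]
    rw [norm_mul, norm_pow, ← hsp, spectralNorm_extends]
    rfl
  have hdist : ∀ i ∈ (Finset.univ : Finset (Fin pb.dim)), ∀ j ∈ (Finset.univ : Finset (Fin pb.dim)),
      f i ≠ 0 → f j ≠ 0 → ‖f i‖ = ‖f j‖ → i = j := by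
    intro i _ j _ hi hj hij
    have hci : c i ≠ 0 := by
      intro h0; apply hi; simp [hf, h0]
    have hcj : c j ≠ 0 := by
      intro h0; apply hj; simp [hf, h0]
    rw [hnf, hnf] at hij
    exact Fin.ext (eq_of_norm_mul_pow_eq hπ0 hπ hval ht hα hci hcj i.2 j.2 hij)
  have hne : ∑ i ∈ Finset.univ, f i ≠ 0 := by rwa [← hyf]
  obtain ⟨i₀, -, hi₀, h1, h2⟩ :=
    exists_norm_sum_eq_norm_and_lt Finset.univ f hdist hne
  refine ⟨i₀, ?_, ?_, ?_⟩
  · intro h0; apply hi₀; simp [hf, h0]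
  · rw [hsp, hyf, h1, hnf]
  · rw [hsp, ← hnf i₀]
    have : y - c i₀ • pb.gen ^ (i₀ : ℕ) = ∑ i, f i - f i₀ := by rw [← hyf]
    rw [this]
    exact h2

/-- **Structure of a totally ramified extension with a power basis** `1, α, …, α^{d-1}`,
`‖α‖^d = ‖π‖` (`π` a uniformizer of the discretely valued `K`): every `x ∈ Lˣ` is
`x = α^i · π^k · b · (1 + m)` with `b ∈ K`, `‖b‖ = 1` and `‖m‖ < 1` — i.e. `|Lˣ| = |α|^ℤ`, `α` is a
uniformizer of `L`, and the residue field of `L` is that of `K` (`e = d`, `f = 1`).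
Ref: Serre, *Local Fields*, Ch. I §6 Prop. 17–18 (Eisenstein equations give totally ramified
extensions); Cassels–Fröhlich Ch. I §6 Thm. 1. [folklore] -/
theorem exists_eq_pow_mul_mul_one_add {π : K} (hπ0 : 0 < ‖π‖) (hπ : ‖π‖ < 1)
    (hval : ∀ x : K, x ≠ 0 → ∃ k : ℤ, ‖x‖ = ‖π‖ ^ k) (pb : PowerBasis K L)
    (hα : spectralNorm K L pb.gen ^ pb.dim = ‖π‖) {x : L} (hx : x ≠ 0) :
    ∃ (i : ℕ) (k : ℤ) (b : K) (m : L), ‖b‖ = 1 ∧ spectralNorm K L m < 1 ∧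
      x = pb.gen ^ i * algebraMap K L (π ^ k * b) * (1 + m) := by
  letI := spectralNorm.normedField K L
  have hsp : ∀ z : L, spectralNorm K L z = ‖z‖ := fun z => rfl
  set t := spectralNorm K L pb.gen with ht_def
  have hπ0' : π ≠ 0 := norm_pos_iff.mp hπ0
  have hπL : ‖algebraMap K L π‖ = ‖π‖ := spectralNorm_extends π
  have hgen0 : pb.gen ≠ 0 := by
    intro h0
    rcases Nat.eq_zero_or_pos pb.dim with hd | hd
    · rw [hd, pow_zero] at hα; exact hπ.ne hα.symm
    · have ht0 : t = 0 := by rw [ht_def, h0, spectralNorm_zero]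
      rw [ht0, zero_pow hd.ne'] at hα; exact hπ0.ne hα
  -- Step 1: dominant term of `x`
  obtain ⟨i₀, hc0, hnx, -⟩ := exists_dominant_term K L hπ0 hπ hval pb hα hx
  obtain ⟨k, hk⟩ := hval _ hc0
  -- Step 2: normalise
  set w : L := pb.gen ^ (i₀ : ℕ) * algebraMap K L (π ^ k) with hw
  have hw0 : w ≠ 0 :=
    mul_ne_zero (pow_ne_zero _ hgen0) ((map_ne_zero (algebraMap K L)).mpr (zpow_ne_zero k hπ0'))
  have hnw : ‖w‖ = ‖x‖ := by
    rw [← hsp x, hnx, hk, hw, norm_mul, norm_pow, map_zpow₀, norm_zpow, hπL, mul_comm]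
    rfl
  set y : L := x / w with hy
  have hy0 : y ≠ 0 := div_ne_zero hx hw0
  have hny : ‖y‖ = 1 := by rw [hy, norm_div, hnw, div_self (norm_ne_zero_iff.mpr hx)]
  -- Step 3: dominant term of `y` is the constant term
  obtain ⟨i₁, hc1, hny', hrest⟩ := exists_dominant_term K L hπ0 hπ hval pb hα hy0
  have ht : 0 < t := by
    rcases (spectralNorm_nonneg (K := K) pb.gen).eq_or_lt with h | h
    · exact absurd (eq_zero_of_map_spectralNorm_eq_zero h.symm (Algebra.IsAlgebraic.isAlgebraic _))
        hgen0
    · exact h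
  have hdpos : 0 < pb.dim := by
    rcases Nat.eq_zero_or_pos pb.dim with hd | hd
    · rw [hd, pow_zero] at hα; exact absurd hα.symm hπ.ne
    · exact hd
  have hi₁ : (i₁ : ℕ) = 0 := by
    refine eq_of_norm_mul_pow_eq hπ0 hπ hval ht hα hc1 one_ne_zero i₁.2 hdpos ?_
    rw [norm_one, pow_zero, one_mul, ← hny', hsp, hny]
  set b : K := pb.basis.repr y i₁ with hb
  have hnb : ‖b‖ = 1 := by
    have := hny'
    rw [hi₁, pow_zero, mul_one, hsp, hny] at this
    exact this.symm
  have hb0 : b ≠ 0 := hc1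
  have hbL : ‖algebraMap K L b‖ = 1 := by rw [← hsp, spectralNorm_extends, hnb]
  -- `y = b (1 + m)` with `m = y/b - 1`
  set m : L := y / algebraMap K L b - 1 with hm
  have hym : y = algebraMap K L b * (1 + m) := by
    rw [hm, add_sub_cancel, mul_div_cancel₀ _ (by simpa using hb0 : algebraMap K L b ≠ 0)]
  have hbL0 : algebraMap K L b ≠ 0 := by simpa using hb0
  have hnm : ‖m‖ < 1 := by
    have h2 : ‖y - algebraMap K L b‖ < 1 := by
      have := hrest
      rw [hi₁, pow_zero, pow_zero, mul_one, hnb, Algebra.smul_def, mul_one] at this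
      exact this
    have h1 : m = (y - algebraMap K L b) / algebraMap K L b := by
      rw [hm, sub_div, div_self hbL0]
    rw [h1, norm_div, hbL, div_one]
    exact h2
  refine ⟨i₀, k, b, m, hnb, hnm, ?_⟩
  calc x = w * y := by rw [hy, mul_div_cancel₀ _ hw0]
    _ = pb.gen ^ (i₀ : ℕ) * algebraMap K L (π ^ k * b) * (1 + m) := by
      rw [hym, hw, map_mul, map_zpow₀]; ring

/-- **Norms of principal units are principal units**: for a finite Galois `L/K` and `m ∈ L` with
`‖m‖ < 1` (spectral norm), `‖N_{L/K}(1 + m) - 1‖ < 1`, since `N(1 + m) = ∏_σ (1 + σ m)` with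
`‖σ m‖ = ‖m‖` (uniqueness of the extended absolute value).  Ref: Serre, *Local Fields*, Ch. V §2
(the norm maps `U_L^{(1)}` into `U_K^{(1)}`); Ch. II §2 Cor. 3 (`w ∘ σ = w`). [folklore] -/
theorem norm_algebraNorm_one_add_sub_one_lt [IsGalois K L] {m : L} (hm : spectralNorm K L m < 1) :
    ‖Algebra.norm K (1 + m) - 1‖ < 1 := by
  letI := spectralNorm.normedField K L
  haveI : IsUltrametricDist L :=
    IsUltrametricDist.isUltrametricDist_of_forall_norm_add_le_max_norm
      (fun a b => isNonarchimedean_spectralNorm (K := K) (L := L) a b)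
  have hsp : ∀ z : L, spectralNorm K L z = ‖z‖ := fun z => rfl
  classical
  -- `∏_{σ ∈ s} (1 + σ m) - 1` has norm `< 1`, by induction on `s`
  have key : ∀ s : Finset (L ≃ₐ[K] L), ‖(∏ σ ∈ s, (1 + σ m)) - 1‖ < 1 := by
    intro s
    induction s using Finset.induction_on with
    | empty => simp
    | insert σ s hσ ih =>
      rw [Finset.prod_insert hσ]
      have hσm : ‖σ m‖ < 1 := by rw [← hsp, ← spectralNorm_eq_of_equiv σ m]; exact hm
      have hP : ‖∏ τ ∈ s, (1 + τ m)‖ ≤ 1 := by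
        have : ∏ τ ∈ s, (1 + τ m) = (∏ τ ∈ s, (1 + τ m) - 1) + 1 := by ring
        rw [this]
        refine (IsUltrametricDist.norm_add_le_max _ _).trans (max_le ih.le ?_)
        rw [norm_one]
      have : (1 + σ m) * ∏ τ ∈ s, (1 + τ m) - 1 =
          (∏ τ ∈ s, (1 + τ m) - 1) + σ m * ∏ τ ∈ s, (1 + τ m) := by ring
      rw [this]
      refine (IsUltrametricDist.norm_add_le_max _ _).trans_lt (max_lt ih ?_)
      rw [norm_mul]
      calc ‖σ m‖ * ‖∏ τ ∈ s, (1 + τ m)‖ ≤ ‖σ m‖ * 1 := by gcongr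
        _ < 1 := by rw [mul_one]; exact hσm
  have h := key Finset.univ
  have h' : ∏ σ : L ≃ₐ[K] L, σ (1 + m) = ∏ σ : L ≃ₐ[K] L, (1 + σ m) :=
    Finset.prod_congr rfl (fun σ _ => by rw [map_add, map_one])
  rw [← h', ← Algebra.norm_eq_prod_automorphisms K (1 + m)] at h
  rw [← spectralNorm_extends (K := K) (L := L) (Algebra.norm K (1 + m) - 1), _root_.map_sub, map_one]
  exact h

end TotallyRamified




/-! ### Roots of unity and Eisenstein polynomials over a non-archimedean local field -/

section RootsOfUnity

variable (F : Type*) [Field F] [ValuativeRel F] [TopologicalSpace F] [IsNonarchimedeanLocalField F]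

open GaloisRepresentations.IsNonarchimedeanLocalField

/-- **`F` contains the `(q-1)`-th roots of unity** (Teichmüller lifts): a non-archimedean local
field with residue field of `q` elements contains a primitive `(q-1)`-th root of unity (lift a
generator of `𝓀ˣ` and correct it by Hensel's lemma applied to `X^{q-1} - 1`).
Ref: Serre, *Local Fields*, Ch. II §4 Prop. 8 (roots of unity of order prime to `p` via Hensel,
Prop. 7). [cite: SerreLocalFields1979, Ch. II §4 Prop. 8] -/
theorem exists_isPrimitiveRoot_residueFieldCard_sub_one :
    ∃ ζ : F, IsPrimitiveRoot ζ (residueFieldCard F - 1) := by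
  classical
  letI : Fintype 𝓀[F] := Fintype.ofFinite _
  set q := residueFieldCard F with hq
  have hq1 : 1 < q := one_lt_residueFieldCard F
  have hqcard : Fintype.card 𝓀[F] = q := by rw [hq, residueFieldCard, Nat.card_eq_fintype_card]
  -- a generator of `𝓀ˣ` and a lift
  obtain ⟨g, hg⟩ := IsCyclic.exists_generator (α := 𝓀[F]ˣ)
  have hordg : orderOf g = q - 1 := by
    rw [orderOf_eq_card_of_forall_mem_zpowers hg, Nat.card_eq_fintype_card, Fintype.card_units,
      hqcard]
  obtain ⟨g₀, hg₀⟩ := IsLocalRing.residue_surjective (g : 𝓀[F])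
  have hg₀m : g₀ ∉ 𝓂[F] := by
    intro h
    rw [← IsLocalRing.residue_eq_zero_iff, hg₀] at h
    exact g.ne_zero h
  have hg₀v : valuation F (g₀ : F) = 1 := by
    have h1 : valuation F (g₀ : F) ≤ 1 := g₀.2
    have h2 : ¬ valuation F (g₀ : F) < 1 := by
      rwa [← mem_maximalIdeal_iff_valuation_lt_one]
    exact le_antisymm h1 (not_lt.mp h2)
  -- Hensel
  have hn : ((q - 1 : ℕ) : 𝓀[F]) ≠ 0 := by
    rw [Nat.cast_sub hq1.le, hq, cast_residueFieldCard_eq_zero, Nat.cast_one, zero_sub]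
    exact neg_ne_zero.mpr one_ne_zero
  obtain ⟨z, hz, hz1⟩ := exists_pow_eq_of_sub_one_mem_maximalIdeal hn
    (pow_residueFieldCard_sub_one_sub_one_mem hg₀v)
  have hz0 : (z : F) ≠ 0 := by
    intro h0
    have : z ∈ 𝓂[F] := by
      rw [mem_maximalIdeal_iff_valuation_lt_one, h0, map_zero]; exact zero_lt_one
    have h1 : (1 : 𝒪[F]) ∈ 𝓂[F] := by
      have := Ideal.sub_mem _ this hz1
      rwa [sub_sub_cancel] at this
    exact (IsLocalRing.maximalIdeal.isMaximal 𝒪[F]).ne_top (Ideal.eq_top_of_isUnit_mem _ h1 isUnit_one)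
  refine ⟨(g₀ : F) / z, ?_⟩
  rw [IsPrimitiveRoot.iff_def]
  constructor
  · rw [div_pow, div_eq_one_iff_eq (pow_ne_zero _ hz0), ← SubmonoidClass.coe_pow, ← SubmonoidClass.coe_pow, hz]
  · intro l hl
    rw [div_pow, div_eq_one_iff_eq (pow_ne_zero _ hz0), ← SubmonoidClass.coe_pow,
      ← SubmonoidClass.coe_pow] at hl
    have hl' : g₀ ^ l = z ^ l := Subtype.ext hl
    have hres : (g : 𝓀[F]) ^ l = 1 := by
      have h1 : IsLocalRing.residue 𝒪[F] z = 1 := by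
        rw [← sub_eq_zero, ← map_one (IsLocalRing.residue 𝒪[F]), ← _root_.map_sub,
          IsLocalRing.residue_eq_zero_iff]
        exact hz1
      rw [← hg₀, ← map_pow, hl', map_pow, h1, one_pow]
    have hgl : g ^ l = 1 := Units.ext (by simpa using hres)
    rw [← hordg]
    exact orderOf_dvd_of_pow_eq_one hgl

/-- **Eisenstein**: `X^d - c` is irreducible over `F` for a uniformizer `c` and `d ≥ 1`
(Eisenstein's criterion at `𝔭 = 𝓂[F]` over `𝒪[F]`, then Gauss's lemma).
Ref: Serre, *Local Fields*, Ch. I §6 Prop. 17; Cassels–Fröhlich Ch. I §6. [folklore] -/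
theorem irreducible_X_pow_sub_C_of_isUniformizer {c : F} (hc : (valuation F).IsUniformizer c)
    {d : ℕ} (hd : 0 < d) : Irreducible (X ^ d - C c : F[X]) := by
  have hc1 : valuation F c ≤ 1 := hc.val_lt_one.le
  set c₀ : 𝒪[F] := ⟨c, hc1⟩ with hc₀
  have hc₀m : c₀ ∈ 𝓂[F] := (mem_maximalIdeal_iff_valuation_lt_one _).mpr hc.val_lt_one
  set f : 𝒪[F][X] := X ^ d - C c₀ with hf
  have hfm : f.Monic := monic_X_pow_sub_C c₀ hd.ne'
  have hdeg : f.degree = d := degree_X_pow_sub_C hd c₀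
  -- Eisenstein at `𝓂[F]`
  have hirr : Irreducible f := by
    refine irreducible_of_eisenstein_criterion
      (IsLocalRing.maximalIdeal.isMaximal 𝒪[F]).isPrime ?_ ?_ ?_ ?_ hfm.isPrimitive
    · rw [hfm.leadingCoeff]
      exact (IsLocalRing.maximalIdeal.isMaximal 𝒪[F]).ne_top ∘
        fun h => Ideal.eq_top_of_isUnit_mem _ h isUnit_one
    · intro n hn
      rw [hdeg, Nat.cast_lt] at hn
      rw [hf, coeff_sub, coeff_X_pow, if_neg hn.ne, coeff_C, zero_sub, Ideal.neg_mem_iff]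
      split_ifs
      · exact hc₀m
      · exact Ideal.zero_mem _
    · rw [hdeg]; exact_mod_cast hd
    · -- `coeff 0 = -c₀ ∉ 𝓂²`: elements of `𝓂²` have valuation `≤ v(π)²`
      rw [hf, coeff_sub, coeff_X_pow, if_neg hd.ne, coeff_C_zero, zero_sub, Ideal.neg_mem_iff]
      intro hmem
      have key : ∀ x ∈ 𝓂[F] ^ 2, valuation F (x : F) ≤ valuation F c * valuation F c := by
        intro x hx
        rw [pow_two] at hx
        refine Submodule.mul_induction_on hx (fun a ha b hb => ?_) (fun a b ha hb => ?_)
        · rw [Subring.coe_mul, Valuation.map_mul]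
          have hle : ∀ y ∈ 𝓂[F], valuation F (y : F) ≤ valuation F c := fun y hy => by
            rw [show valuation F c = unifValue F from hc]
            exact (valuation_le_unifValue_iff_lt_one F _).mpr
              ((mem_maximalIdeal_iff_valuation_lt_one _).mp hy)
          exact mul_le_mul' (hle a ha) (hle b hb)
        · rw [Subring.coe_add]
          exact (Valuation.map_add _ _ _).trans (max_le ha hb)
      have := key c₀ hmem
      have hc0 : valuation F c ≠ 0 := hc.val_ne_zero
      have : valuation F c * 1 ≤ valuation F c * valuation F c := by rwa [mul_one]
      have := le_of_mul_le_mul_left this (zero_lt_iff.mpr hc0)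
      exact absurd this (not_le.mpr hc.val_lt_one)
  -- Gauss
  have := (hfm.irreducible_iff_irreducible_map_fraction_map (K := F)).mp hirr
  have hmap : f.map (algebraMap 𝒪[F] F) = X ^ d - C c := by
    rw [hf, Polynomial.map_sub, Polynomial.map_pow, map_X, map_C]
    rfl
  rwa [hmap] at this

end RootsOfUnity



/-! ### The tame level of the Lubin–Tate fact, and the tame existence theorem -/

section TameLevel

open GaloisRepresentations.IsNonarchimedeanLocalField

variable (F : Type*) [Field F] [ValuativeRel F] [TopologicalSpace F] [IsNonarchimedeanLocalField F]

/-- **The Lubin–Tate norm-group fact at level `n = 1`, proved** (`exists_abelian_norm_le_lubinTate`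
at `n = 1`; Cassels–Fröhlich VI §3.6 Prop. 6 and Cor. for `K_π^1 = K(E_f^1)`, `f = πX + X^q`, whose
nonzero division points are the roots of the Eisenstein polynomial `X^{q-1} + π`).  For every
uniformizer `π` of the non-archimedean local field `F` (residue field of `q` elements) there is a
finite abelian — indeed cyclic, Kummer — extension `E = F(α) ⊆ F̄`, `α^{q-1} = (-1)^q π`, of degree
`q - 1 = (q-1)q^0`, with `π = N_{E/F}(α) ∈ N(Eˣ)` and `N(Eˣ) ⊆ ⟨π⟩ · U_F^{(1)}`: every `x ∈ Eˣ` is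
`α^i π^k b (1 + m)` (`b ∈ 𝒪_Fˣ`, `‖m‖ < 1`; `E/F` is totally ramified), and
`N(x) = π^{i+k(q-1)} · b^{q-1} N(1+m)` with `b^{q-1} N(1 + m) ≡ 1 mod 𝔭`.  See the module docstring
for the proof and its sources.
Ref: Cassels–Fröhlich (1967), Ch. VI §3.6 Prop. 6, Cor.; Serre, *Local Fields* (1979), Ch. I §6
Prop. 17–18, Ch. II §4 Prop. 8, Ch. V §3.
[cite: CasselsFrohlichANT1967, Ch. VI §3.6 Cor. to Prop. 6 and §3.8] -/
theorem exists_abelian_norm_le_lubinTate_one (π : Fˣ) (hπ : (valuation F).IsUniformizer (π : F)) :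
    ∃ E : IntermediateField F (AlgebraicClosure F), FiniteDimensional F E ∧ IsAbelianGalois F E ∧
      Module.finrank F E = (residueFieldCard F - 1) * residueFieldCard F ^ (1 - 1) ∧
      π ∈ (Units.map (Algebra.norm F : E →* F)).range ∧
      (Units.map (Algebra.norm F : E →* F)).range ≤ Subgroup.zpowers π ⊔ higherUnitGroup F 1 := by
  classical
  -- the normed structure on `F`
  letI : UniformSpace F := IsTopologicalAddGroup.rightUniformSpace F
  haveI : IsUniformAddGroup F := isUniformAddGroup_of_addCommGroup
  letI hv1 : (Valued.v (R := F)).RankOne :=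
  { hom' := IsRankLeOne.nonempty.some.emb (R := F).comp MonoidWithZeroHom.ValueGroup₀.embedding
    strictMono' := IsRankLeOne.nonempty.some.strictMono.comp
        MonoidWithZeroHom.ValueGroup₀.embedding_strictMono }
  letI hNF : NontriviallyNormedField F := Valued.toNontriviallyNormedField F (ValueGroupWithZero F)
  have hlt : ∀ y : F, ‖y‖ < 1 ↔ valuation F y < 1 := fun y => by
    rw [Valued.toNormedField.norm_lt_one_iff]; rfl
  have heq1 : ∀ y : F, ‖y‖ = 1 ↔ valuation F y = 1 := fun y => by
    rw [le_antisymm_iff, le_antisymm_iff, Valued.toNormedField.norm_le_one_iff,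
      Valued.toNormedField.one_le_norm_iff]
    rfl
  have hlele : ∀ y y' : F, ‖y‖ ≤ ‖y'‖ ↔ valuation F y ≤ valuation F y' := fun y y' => by
    rw [Valued.toNormedField.norm_le_iff]; rfl
  have heqeq : ∀ y y' : F, ‖y‖ = ‖y'‖ ↔ valuation F y = valuation F y' := fun y y' => by
    rw [le_antisymm_iff, le_antisymm_iff, hlele, hlele]
  -- numerology
  set q := residueFieldCard F with hq
  have hq1 : 1 < q := one_lt_residueFieldCard F
  set d := q - 1 with hd_def
  have hd : 0 < d := by omega
  have hdq : d + 1 = q := by omega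
  haveI : NeZero d := ⟨hd.ne'⟩
  -- the uniformizer `c = (-1)^q π` and the polynomial `X^d - c`
  have hπ0 : (π : F) ≠ 0 := π.ne_zero
  have hπv : valuation F (π : F) = unifValue F := hπ
  have hπn1 : ‖(π : F)‖ < 1 := (hlt _).mpr hπ.val_lt_one
  have hπn0 : 0 < ‖(π : F)‖ := norm_pos_iff.mpr hπ0
  set c : F := (-1) ^ q * π with hc
  have hcu : (valuation F).IsUniformizer c := by
    change valuation F c = unifValue F
    rw [hc, Valuation.map_mul, Valuation.map_pow, Valuation.map_neg, Valuation.map_one, one_pow,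
      one_mul, hπv]
  have hcn : ‖c‖ = ‖(π : F)‖ := by rw [hc, norm_mul, norm_pow, norm_neg, norm_one, one_pow, one_mul]
  obtain ⟨ζ, hζ⟩ := exists_isPrimitiveRoot_residueFieldCard_sub_one F
  have hζ' : (primitiveRoots d F).Nonempty := ⟨ζ, (mem_primitiveRoots hd).mpr hζ⟩
  have hirr : Irreducible (X ^ d - C c) := irreducible_X_pow_sub_C_of_isUniformizer F hcu hd
  -- a root `α ∈ F̄` and `E = F(α)`
  obtain ⟨α, hα⟩ := IsAlgClosed.exists_pow_nat_eq (algebraMap F (AlgebraicClosure F) c) hd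
  have hαi : IsIntegral F α := Algebra.IsIntegral.isIntegral α
  have hmin : minpoly F α = X ^ d - C c :=
    (minpoly.eq_of_irreducible_of_monic hirr (by simp [hα]) (monic_X_pow_sub_C c hd.ne')).symm
  set E : IntermediateField F (AlgebraicClosure F) := IntermediateField.adjoin F {α} with hE
  haveI hfd : FiniteDimensional F E := IntermediateField.adjoin.finiteDimensional hαi
  have hfinrank : Module.finrank F E = d := by
    rw [hE, IntermediateField.adjoin.finrank hαi, hmin, natDegree_X_pow_sub_C]
  set pb : PowerBasis F E := IntermediateField.adjoin.powerBasis hαi with hpb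
  have hpbgen : pb.gen = IntermediateField.AdjoinSimple.gen F α := rfl
  have hpbdim : pb.dim = d := by
    rw [hpb, IntermediateField.adjoin.powerBasis_dim, hmin, natDegree_X_pow_sub_C]
  have hgen_d : pb.gen ^ d = algebraMap F E c := by
    apply Subtype.ext
    rw [hpbgen, SubmonoidClass.coe_pow, IntermediateField.AdjoinSimple.coe_gen, hα]
    rfl
  have hgen0 : pb.gen ≠ 0 := by
    intro h0
    have : (algebraMap F E c) = 0 := by rw [← hgen_d, h0, zero_pow hd.ne']
    exact hcu.ne_zero ((map_eq_zero _).mp this)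
  -- Kummer theory: `E/F` is cyclic Galois
  have htop : IntermediateField.adjoin F {pb.gen} = ⊤ :=
    (IntermediateField.adjoin_simple_eq_top_iff_of_isAlgebraic
      (Algebra.IsAlgebraic.isAlgebraic pb.gen)).mpr pb.adjoin_gen_eq_top
  have hsplit : IsSplittingField F E (X ^ d - C c) := by
    have h := isSplittingField_X_pow_sub_C_of_root_adjoin_eq_top (K := F) (L := E)
      (hfinrank ▸ hζ') (a := c) (α := pb.gen) (by rw [hfinrank]; exact hgen_d) htop
    rwa [hfinrank] at h
  haveI := hsplit
  haveI hgal : IsGalois F E := isGalois_of_isSplittingField_X_pow_sub_C hζ' hirr E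
  haveI : IsCyclic (E ≃ₐ[F] E) := isCyclic_of_isSplittingField_X_pow_sub_C hζ' hirr E
  have hab : IsAbelianGalois F E := IsAbelianGalois.of_isCyclic F E
  -- `N(α) = π`
  have hNα : Algebra.norm F pb.gen = π := by
    have h := Algebra.PowerBasis.norm_gen_eq_coeff_zero_minpoly pb
    rw [hpbdim, hpbgen, IntermediateField.minpoly_gen, hmin] at h
    rw [hpbgen, h, coeff_sub, coeff_X_pow, if_neg hd.ne, coeff_C_zero, zero_sub, hc, ← hdq,
      pow_succ]
    have h1 : ((-1 : F) ^ d) ^ 2 = 1 := by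
      rw [← pow_mul, mul_comm, pow_mul, neg_one_sq, one_pow]
    linear_combination (π : F) * h1
  -- spectral data on `E`
  have hval : ∀ x : F, x ≠ 0 → ∃ k : ℤ, ‖x‖ = ‖(π : F)‖ ^ k := by
    intro x hx
    obtain ⟨k, hk⟩ := exists_valuation_eq_unifValue_zpow F hx
    refine ⟨k, ?_⟩
    rw [← norm_zpow, heqeq, hk, map_zpow₀, hπv]
  have hαnorm : spectralNorm F E pb.gen ^ pb.dim = ‖(π : F)‖ := by
    letI := spectralNorm.normedField F E
    rw [hpbdim, show spectralNorm F E pb.gen = ‖pb.gen‖ from rfl, ← norm_pow, hgen_d,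
      show ‖algebraMap F E c‖ = spectralNorm F E (algebraMap F E c) from rfl, spectralNorm_extends,
      hcn]
  -- conclusion
  refine ⟨E, hfd, hab, ?_, ?_, ?_⟩
  · rw [hfinrank, Nat.sub_self, pow_zero, mul_one]
  · refine ⟨Units.mk0 pb.gen hgen0, Units.ext ?_⟩
    simp [hNα]
  · rintro _ ⟨x, rfl⟩
    obtain ⟨i, k, b, m, hb, hm, hx⟩ :=
      exists_eq_pow_mul_mul_one_add hπn0 hπn1 hval pb hαnorm (x.ne_zero)
    -- the unit part `u = b^d · N(1+m)` is a principal unit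
    have hbv : valuation F b = 1 := (heq1 b).mp hb
    have hb0 : b ≠ 0 := fun h => by rw [h, norm_zero] at hb; exact zero_ne_one hb
    have hN1 : valuation F (Algebra.norm F (1 + m) - 1) < 1 :=
      (hlt _).mp (norm_algebraNorm_one_add_sub_one_lt hm)
    have hbd : valuation F (b ^ d - 1) < 1 := by
      have h := pow_residueFieldCard_sub_one_sub_one_mem (x := (⟨b, hbv.le⟩ : 𝒪[F])) hbv
      rw [mem_maximalIdeal_iff_valuation_lt_one] at h
      exact h
    have hN0 : Algebra.norm F (1 + m) ≠ 0 := by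
      intro h0
      rw [h0, zero_sub, Valuation.map_neg, Valuation.map_one] at hN1
      exact lt_irrefl _ hN1
    set u₀ : F := b ^ d * Algebra.norm F (1 + m) with hu₀
    have hu₀0 : u₀ ≠ 0 := mul_ne_zero (pow_ne_zero _ hb0) hN0
    have hu₀1 : valuation F (u₀ - 1) < 1 := by
      have : u₀ - 1 = b ^ d * (Algebra.norm F (1 + m) - 1) + (b ^ d - 1) := by rw [hu₀]; ring
      rw [this]
      refine (Valuation.map_add _ _ _).trans_lt (max_lt ?_ hbd)
      rw [Valuation.map_mul, Valuation.map_pow, hbv, one_pow, one_mul]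
      exact hN1
    have hu : Units.mk0 u₀ hu₀0 ∈ higherUnitGroup F 1 := by
      rw [mem_higherUnitGroup_iff_of_pos F Nat.one_pos, pow_one, valuation_le_unifValue_iff_lt_one]
      exact hu₀1
    refine Subgroup.mem_sup.mpr ⟨π ^ ((i : ℤ) + k * d), Subgroup.zpow_mem _ (Subgroup.mem_zpowers π) _,
      Units.mk0 u₀ hu₀0, hu, Units.ext ?_⟩
    rw [Units.val_mul, Units.val_zpow_eq_zpow_val, Units.val_mk0, Units.coe_map, hx, map_mul,
      map_mul, map_pow, hNα, Algebra.norm_algebraMap, hfinrank, hu₀, zpow_add₀ hπ0, zpow_natCast,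
      zpow_mul, zpow_natCast, mul_pow]
    ring

/-- **The tame existence theorem from the reciprocity law alone.**  For a non-archimedean local
field `F`, granting the reciprocity law `localReciprocityLaw F` (Serre XIII §4), every finite-index
subgroup `U ≤ Fˣ` containing the principal units `U^{(1)} = 1 + 𝔭` is a norm group
`U = N_{E/F}(Eˣ)` of a finite abelian `E ⊆ F̄` — Serre XIV §6 Thm. 1 for the (open) subgroups
`U ⊇ U_F^{(1)}`, i.e. the norm groups of tamely ramified abelian extensions.  Proof:
`isNormSubgroup_of_higherUnitGroup_le` at `n = 1` with the proved tame level
`exists_abelian_norm_le_lubinTate_one` and `h₁, h₂` (Serre XI §4 Prop. 4) from the reciprocity law.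
Ref: Serre, *Local Fields* (1979), Ch. XIV §6 Thm. 1 and Cor. 1; Cassels–Fröhlich Ch. VI §3.8.
[cite: SerreLocalFields1979, Ch. XIV §6 Thm. 1] -/
theorem isNormSubgroup_of_higherUnitGroup_one_le (hrec : localReciprocityLaw F) (U : Subgroup Fˣ)
    [U.FiniteIndex] (hU : higherUnitGroup F 1 ≤ U) : IsNormSubgroup F U := by
  obtain ⟨π, hπ⟩ := exists_isUniformizer F
  obtain ⟨E, hfd, hab, -, -, hle⟩ := exists_abelian_norm_le_lubinTate_one F π hπ
  exact isNormSubgroup_of_higherUnitGroup_le F (isNormSubgroup_inf_of_reciprocity hrec)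
    (isNormSubgroup_of_le_of_reciprocity hrec) hπ ⟨E, hfd, hab, hle⟩ U hU

/-- The same with Mathlib's `principalUnitGroup` (`= higherUnitGroup F 1`): granting the reciprocity
law, every finite-index subgroup of `Fˣ` containing the principal units `1 + 𝔭` of the valuation
ring is a norm group. [cite: SerreLocalFields1979, Ch. XIV §6 Thm. 1] -/
theorem isNormSubgroup_of_principalUnitGroup_le (hrec : localReciprocityLaw F) (U : Subgroup Fˣ)
    [U.FiniteIndex] (hU : (valuation F).valuationSubring.principalUnitGroup ≤ U) :
    IsNormSubgroup F U :=
  isNormSubgroup_of_higherUnitGroup_one_le F hrec U ((higherUnitGroup_one F).le.trans hU)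

end TameLevel

end Literature.NumberTheory.GaloisRepresentations
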